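/-
Copyright: pub-hodgecm formalisation cell (harness21, 2026). New file (not vendored).
-/
import Summits.HodgeConjecture.HodgeCM.Automorphic.Realisation
import Summits.HodgeConjecture.HodgeCM.StubTree.Combinatorics
import Summits.HodgeConjecture.HodgeCM.StubTree.Inputs

/-!
# Stub tree, part 1: the proof of PerL Thm 4.4 and its transposition to rfwf Thm 4.1

Numbering follows PerL v5 (d912a121) §§3–4 as summarised in the follow-ups doc §B.1/B.3 and in
`typing-check-perL.md`; tex line numbers are those quoted in the prior programme's docstrings
(`HodgeCM.Prior.Perl34`). Since gen 6 this file contains no placeholder proof: the unproved steps are the named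
`Prop`s of `HodgeCM.StubTree.Inputs` (`HodgeCM.Lemma33bLandherr`, `Universe.RealisationExistsPerL`,
`Universe.RealisationExistsFace`), taken as explicit hypotheses by the wiring theorems below; every other
theorem is proved here (wiring) or in `HodgeCM.Prior.*` (machine-checked legs of the 2001 programme,
re-exported by `alias`).

```
Def 3.2  seesaw plane W = W₁⊕W₂ ≅ W₃⊕W₄        `SeesawDatum` (data) + `HodgeCM.Lemma33bLandherr` (named open target, Landherr)
L 3.3(a) allowed pairs have the forced ∞-type     `lemma33a`  (PROVED: Prior.Perl34.C3a)
L 3.3(b) signatures forced by Ψ agree (pair-sum)   `pairSum_of_isPerLTypes` (PROVED, Combinatorics; Bool version: Prior.Signatures)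
L 3.5    theta one-forms ↔ generators of S₁₂/S₃₄   fields `ThetaRealisation.gen12` (seesaw direction) / `real34` (generation);
                                                   existence: hypotheses `Universe.RealisationExistsPerL/Face` (open inputs)
P 3.6    isolation 𝒯_Φ(L²_w) ⊆ S₁₂                 `prop36`    (PROVED: Prior.Perl34.C1_prop36)
T 3.7    S₁₂ = S₃₄ = closure Σ_Φ 𝒯_Φ(L²)           `thm37`     (PROVED: Prior.Perl34.C2_thm37)
L 4.1(c) (†) occurrence of w in σ_∞|_T             `lemma41c`  (PROVED modulo `OccDischarge` fields: Prior.Perl34.C4a.H_occ)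
L 4.2(a) theta lifts θ_φ(χ) ≠ 0 (Rallis)           `lemma42a`  (PROVED modulo `RallisDatum`: Prior.Perl34.C4.θvec_ne_zero);
                                                   on the surface: theorem `ThetaRealisation.supply` (gen 7: derived from `lineField`)
L 4.2(b) every χ with χ_∞ = w is allowed          `lemma42b`  (PROVED modulo `CharsDischarge` fields: Prior.Perl34.C4.H_chars)
P 4.3    ∃ u₁∧u₂ ≠ 0; S₁₂ ≠ 0                     `prop43`    (PROVED over the interface from the field `lineField` = Prop 4.3's ∃, gen 7)
T 4.4    ∀(V₃,h) ∃Γ: period ≠ 0                    `thm44_of_realisation` (PROVED over the interface) → `perL44_holds` (PROVED wiring)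
§4.2 rfwf transposition (T1)–(T3), six-item audit  hypothesis `Universe.RealisationExistsFace` → `periodThmF_holds` (PROVED wiring)
```
So the whole of PerL §§3–4 downstream of the EXISTENCE of the realisation data is machine-checked: the two
open inputs of this file with mathematical content are `Universe.RealisationExistsPerL` and
`Universe.RealisationExistsFace` (plus the independent algebra target `HodgeCM.Lemma33bLandherr`, consumed
inside their informal proofs) — all three are definitions in `HodgeCM.StubTree.Inputs`, none is asserted.
-/

noncomputable section

open scoped TensorProduct InnerProductSpace Matrix

namespace HodgeCM

open Literature.AlgebraicGeometry.Motives (CMType)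
open Literature.AlgebraicGeometry.ShimuraVarieties (conjRingHomK)
open HodgeCM.Prior.Perl34File

namespace StubTree

/-! ### Def 3.2 and Lemma 3.3 -/

/-- **Def 3.2 (data)** (PerL tex ll. 269–279): four hermitian LINES `W_i = (L, a_i x ȳ)` over the surface
field `L` (`a_i ∈ L₀^×`) and an isometry of hermitian planes `W₁ ⊕ W₂ ≅ W₃ ⊕ W₄ =: W` (the seesaw plane),
rendered as a `GL₂(L)`-congruence of the diagonal Gram matrices. TYPING NOTE: the embedding of the
dual pairs `(U(W_i), U(V₃))` and the splitting characters `μ₁μ₂ = μ_W` of Def 3.2 are not typed here;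
they live behind the fields of `Perl34.TorusData` (`allowed`, `X`). -/
structure SeesawDatum (L : CMField) where
  /-- the four line discriminants -/
  a : Fin 4 → L
  a_real : ∀ i, conjRingHomK L (a i) = a i
  a_ne : ∀ i, a i ≠ 0
  /-- `W₁ ⊕ W₂ ≅ W₃ ⊕ W₄`: `gᴴ · diag(a₀, a₁) · g = diag(a₂, a₃)` for some `g ∈ GL₂(L)` -/
  iso : ∃ g : GL (Fin 2) L,
    ((g : Matrix (Fin 2) (Fin 2) L).transpose.map (conjRingHomK L)) * Matrix.diagonal ![a 0, a 1] *
      (g : Matrix (Fin 2) (Fin 2) L) = Matrix.diagonal ![a 2, a 3]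

/-- **Lemma 3.3(a)** (PerL tex ll. 280–298): allowed pairs have the forced archimedean type — machine-checked
in the prior programme over the abstract character layer. -/
alias lemma33a := Perl34.C3a.AllowedDatum.lem_allowed_a

/-- **Lemma 3.3(b), Landherr half** — since gen 6 the classification statement is the named target
`HodgeCM.Lemma33bLandherr` (`HodgeCM.StubTree.Inputs`; Landherr 1936 — verbatim in Rogawski 1990 §1.9 pp. 9–10, Shimura 2008 Thm 2.2); this
abbreviation keeps the gen 1–5 name in place.  PROVED with no hypothesis since run 22: `HodgeCM.lemma33bLandherr_holds`
(`HodgeCM/Literature/NormTheoremHolds.lean`, via run 21 `lemma33bLandherr_of_normTheorem` and run 14 `lemma33bLandherr_of_hasseMinkowski`, Hasse–Minkowski and the quaternion norm theorem being theorems over the vendored cone `HodgeCM/Vendored/H21/**`; converse PROVED outright, `LandherrNecessity.lean`, run 15); not in the cone of the headline theorems. -/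
abbrev lemma33b_landherr_statement : Prop := HodgeCM.Lemma33bLandherr

/-! ### Prop 3.6, Thm 3.7, Lemma 4.1(c), Lemma 4.2 — the machine-checked legs (re-exported) -/

/-- **Prop 3.6** `prop:isol` (PerL ll. 397–439): under `H_chars`, `𝒯_Φ(L²_w) ⊆ S₁₂` — PROVED (prior programme). -/
alias prop36 := Perl34.TorusData.C1_prop36

/-- **Thm 3.7** `thm:R` (PerL ll. 440–458): `S₁₂ = S₃₄ = closure Σ_Φ 𝒯_Φ(L²([U(W)]))` — PROVED (prior programme). -/
alias thm37 := Perl34.IsolationSetting.C2_thm37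

/-- **Lemma 4.1(c)** (the (†) of PerL ll. 442–443): occurrence of `w` in `σ_∞|_T` whenever `𝒯_Φ|_{σ̂} ≠ 0` —
PROVED modulo the archimedean fields of `OccDischarge` (prior programme C4a). -/
alias lemma41c := Perl34.C4a.OccDischarge.H_occ

/-- **Lemma 4.2(a)** (Rallis inner product formula ⇒ `θ_φ(χ) ≠ 0`): PROVED modulo the local data of
`RallisDatum`/`CharsDischarge` (prior programme C4: convergent Euler product with positive tail). -/
alias lemma42a := Perl34.C4.CharsDischarge.θvec_ne_zero

/-- **Lemma 4.2(b)** (PerL ll. 398–400): every character `χ` of `[T]` with `χ_∞ = w` arises from an allowed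
pair — PROVED modulo the fields of `CharsDischarge` (prior programme C4). -/
alias lemma42b := Perl34.C4.CharsDischarge.H_chars

/-! ### Existence of the realisation data (Lemma 3.5 + typing + Lemma 4.2(a) + line field) — PerL setting -/

/-! **Realisation, PerL setting** — since gen 6 the existence statement is the named open input
`HodgeCM.Universe.RealisationExistsPerL` (`HodgeCM.StubTree.Inputs`), a hypothesis of `perL44_holds` and of
`HodgeCM.Assembly.perL`; gen 1–5 had it as the stub `realisation_exists_perL`. -/

/-! ### Prop 4.3 and Thm 4.4 over the abstract realisation — PROVED -/

/-- **Prop 4.3** `prop:S12` (PerL v5 tex ll. 639–684), "in particular `S₁₂ ≠ 0`" — PROVED over the interface: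
`lineField` gives theta one-forms `ω₁ ∈ Θ₀(Γ)`, `ω₂ ∈ Θ₁(Γ)` at some level with `ω₁ ∧ ω₂ ≢ 0`, and `gen12`
(Lemma 3.5, seesaw direction) puts that wedge in `S₁₂`. -/
theorem prop43 {U : Universe} {L : CMField} {ι₁ : L →+* ℂ} {V : HermSpace3 L ι₁}
    {K : CMField} {Ψ : Fin 4 → CMType K} {σ : K →+* ℂ} (R : U.ThetaRealisation ι₁ V K Ψ σ) :
    R.S.t12.S12 ≠ ⊥ := by
  obtain ⟨Γ, ω₁, hω₁, ω₂, hω₂, hv⟩ := R.lineField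
  intro hbot
  have hmem : R.Λ Γ ω₁ ω₂ ∈ R.S.t12.S12 := R.gen12 Γ ω₁ ω₂ hω₁ hω₂
  rw [hbot, Submodule.mem_bot] at hmem
  exact hv hmem

/-- In an inner product space, a vector pairing non-trivially with an element of the closed span of a
set pairs non-trivially with some element of the set. -/
theorem exists_inner_ne_zero_of_mem_closure_span {E : Type*} [NormedAddCommGroup E]
    [InnerProductSpace ℂ E] {s : Set E} {v w : E} (hvw : ⟪v, w⟫_ℂ ≠ 0)
    (hs : w ∈ (Submodule.span ℂ s).topologicalClosure) : ∃ u ∈ s, ⟪v, u⟫_ℂ ≠ 0 := by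
  by_contra h
  simp only [not_exists, not_and, not_not] at h
  have hle : (Submodule.span ℂ s).topologicalClosure ≤ (Submodule.span ℂ {v})ᗮ :=
    Submodule.topologicalClosure_minimal _
      (Submodule.span_le.mpr fun u hu =>
        Submodule.mem_orthogonal_singleton_iff_inner_right.mpr (h u hu))
      (Submodule.isClosed_orthogonal _)
  exact hvw (Submodule.mem_orthogonal_singleton_iff_inner_right.mp (hle hs))

/-- **Thm 4.4 from the realisation** — PROVED over the interface (gen 1 had it as a stub). Proof: a nonzero
(12)-wedge `v = ω₁ ∧ ω₂` of theta one-forms at some level lies in `S₁₂` (`lineField`, `gen12`); `S₁₂ = S₃₄`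
(`thm37`); so `v` pairs non-trivially with some generator `ϑ₃₄(χ,Φ)` of `S₃₄`, which lies in the closed span of
all (34)-wedges of theta one-forms (`real34`, closure form, all `χ` allowed by `H_chars34`), so `v` pairs
non-trivially with one such wedge `ω₃ ∧ ω₄` at some level; pass to a common level (`level_inf`, `Λ_cover`; `U_Ψ` is
pullback-stable by `Fact_pull_comp`), convert the Petersson pairing into the period (`inner_Λ`; `U_Ψ ⊆
H^{1,0}` by `Fact_pull_hodge`), and expand multilinearly to pure pullbacks (`periodNV_of_period_ne_zero`).
Uses of `M`: `pull_comp`, `pull_hodge` only. -/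
theorem thm44_of_realisation {U : Universe} (M : U.ModelAxioms) {L : CMField} {ι₁ : L →+* ℂ}
    {V : HermSpace3 L ι₁} {K : CMField} {Ψ : Fin 4 → CMType K} {σ : K →+* ℂ}
    (R : U.ThetaRealisation ι₁ V K Ψ σ) : U.PeriodNV ι₁ V K Ψ σ := by
  classical
  -- Step 1: a nonzero (12)-wedge of theta one-forms at some level Γ₁ (Prop 4.3); it lies in S₁₂ = S₃₄
  obtain ⟨Γ₁, ω₁, hω₁, ω₂, hω₂, hv⟩ := R.lineField
  have hvS : R.Λ Γ₁ ω₁ ω₂ ∈ R.S.t34.S12 := by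
    rw [← R.S.C2_S12_eq_S34]
    exact R.gen12 Γ₁ ω₁ ω₂ hω₁ hω₂
  -- Step 2: it pairs non-trivially with some generator ϑ₃₄(χ, Φ) of S₃₄
  rw [R.S.t34.S12_def] at hvS
  obtain ⟨u, ⟨χ, -, Φ, rfl⟩, hχ⟩ :=
    exists_inner_ne_zero_of_mem_closure_span (inner_self_ne_zero.mpr hv) hvS
  -- Step 3: that generator lies in the closed span of ALL (34)-wedges of theta one-forms (Lemma 3.5, closure
  -- form), so v pairs non-trivially with one wedge ω₃ ∧ ω₄ at some level Γ₂
  obtain ⟨u, ⟨Γ₂, ω₃, hω₃, ω₄, hω₄, rfl⟩, hu⟩ :=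
    exists_inner_ne_zero_of_mem_closure_span hχ (R.real34 χ (R.S.H_chars34 χ) Φ)
  -- Step 4: pass to a common level
  obtain ⟨Γ, hΓ₁, hΓ₂⟩ := R.level_inf Γ₁ Γ₂
  let ω : Fin 4 → U.CohC (U.pms L ι₁ V Γ) 1 := fun i => match i with
    | 0 => U.pullC (R.cover Γ₁ Γ hΓ₁) 1 ω₁
    | 1 => U.pullC (R.cover Γ₁ Γ hΓ₁) 1 ω₂
    | 2 => U.pullC (R.cover Γ₂ Γ hΓ₂) 1 ω₃
    | 3 => U.pullC (R.cover Γ₂ Γ hΓ₂) 1 ω₄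
  have hU : ∀ i, ω i ∈ U.Uiso Γ K (Ψ i) σ := by
    intro i
    match i with
    | 0 => exact Universe.pullC_mem_Uiso M.pull_comp _ K (Ψ 0) σ (R.Theta_sub 0 Γ₁ hω₁)
    | 1 => exact Universe.pullC_mem_Uiso M.pull_comp _ K (Ψ 1) σ (R.Theta_sub 1 Γ₁ hω₂)
    | 2 => exact Universe.pullC_mem_Uiso M.pull_comp _ K (Ψ 2) σ (R.Theta_sub 2 Γ₂ hω₃)
    | 3 => exact Universe.pullC_mem_Uiso M.pull_comp _ K (Ψ 3) σ (R.Theta_sub 3 Γ₂ hω₄)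
  have hinner : ⟪R.Λ Γ (ω 2) (ω 3), R.Λ Γ (ω 0) (ω 1)⟫_ℂ ≠ 0 := by
    have e12 : R.Λ Γ (ω 0) (ω 1) = R.Λ Γ₁ ω₁ ω₂ := R.Λ_cover Γ₁ Γ hΓ₁ ω₁ ω₂
    have e34 : R.Λ Γ (ω 2) (ω 3) = R.Λ Γ₂ ω₃ ω₄ := R.Λ_cover Γ₂ Γ hΓ₂ ω₃ ω₄
    rw [e12, e34]
    intro h0
    apply hu
    rw [← inner_conj_symm, h0, map_zero]
  -- Step 5: Petersson pairing = period (all four classes are holomorphic one-forms)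
  obtain ⟨c, -, hcΛ⟩ := R.inner_Λ Γ
  have hper : U.period (U.pms L ι₁ V Γ) ω ≠ 0 := by
    have h := hcΛ ω (fun i => Universe.Uiso_le_H10 M.pull_hodge Γ K (Ψ i) σ (hU i))
    intro h0
    rw [h0, mul_zero] at h
    exact hinner h
  -- Step 6: multilinear expansion to pure pullbacks
  exact Universe.periodNV_of_period_ne_zero Γ ω hU hper

/-- **PerL Thm 4.4** `thm:main` — PROVED WIRING from the open input `RealisationExistsPerL`: for every
`(V₃,h)` there is a level with nonzero period. -/
theorem perL44_holds (U : Universe) (M : U.ModelAxioms) (hR : U.RealisationExistsPerL) : U.PerL44 := by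
  intro K L j hN hK hL φ hφ ι₁ hι t ht V
  obtain ⟨R⟩ := hR K L j hN hK hL φ hφ ι₁ hι t ht V
  exact thm44_of_realisation M R

/-! ### The transposition (rfwf v3 §4.2) — the same chain over a Galois CM field `F` and any face -/

/-! **Realisation, face setting** — since gen 6 the existence statement is the named open input
`HodgeCM.Universe.RealisationExistsFace` (`HodgeCM.StubTree.Inputs`), a hypothesis of `periodThmF_holds`
and of `HodgeCM.Assembly.{periodThmF, w_rk4, COR_CM}`; gen 1–5 had it as the stub `realisation_exists_face`. -/

/-- **rfwf Thm 4.1** `thm:period` — PROVED WIRING: the period theorem over `F` from the open input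
`RealisationExistsFace` (the transposed realisation). -/
theorem periodThmF_holds (U : Universe) (M : U.ModelAxioms) (hR : U.RealisationExistsFace) :
    U.PeriodThmF := by
  intro F hG h6 f ι₁ hι V
  obtain ⟨R⟩ := hR F hG h6 f ι₁ hι V
  exact thm44_of_realisation M R

end StubTree

end HodgeCM

end
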